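import Mathlib
import Summits.ResolutionOfSingularities.ResolutionOfSingularities.Theorems.WildQuotientsWildQuotientResolutionJordanThreeChartAlgebra

/-!
# Rung V3, one-blow-up model: the lifted action on the five Rees charts of `K₃ = (x_a⁴, x_a³x_b, x_a²x_b³, x_a x_b⁴, x_b⁶)`

(crux stmt-ResolutionOfSingularities-15640 `WildQuotients.WildQuotientResolution`, line `Sketch`,
sector `|G| = p`; rung V3 of `L/w45c/CHAIN.md` v4, model of record = ONE blow-up of `𝔸ⁿ` along
`K₃` (res-L1-w45c-lead-1 RULING 2026-08-27T01:07:58Z, stub-4 PROPOSAL V3-ONE-BLOWUP; generator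
vector of record `![X a ^ 4, X a ^ 3 * X b, X a ^ 2 * X b ^ 3, X a * X b ^ 4, X b ^ 6]`), item (d)
«five chart computations of the stalk action on the chart generators by non-zero-divisor
cancellation»; [OURS · L1 W4.5c] — NOT a statement of any manuscript; replaces the role of no
printed item. Route-independent: `import Mathlib` + `…JordanThreeChartAlgebra` only.)

Abstract setting, designed to be applied right after
`TerminalBlowup.exists_reesChart_span_stalkAug_eq_sup` (p481478) and `fin_cases` on the chart
index `j : Fin 5`: `S` is the local ring `𝒪_{V,v}` of the blow-up at a fixed point (a DOMAIN),
`xa, xb ≠ 0` the images of `x_a, x_b`, `a : S →+* S` the stalk action of `g = σᵐ`, so that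
`a xa = xa`, `a xb = xb + m xa` with `m` a unit (`JordanThree.exists_law_of_ne_one'`, p481560),
`e l` (`l ≠ j`) the images of the chart generators `c_l / c_j`, with the chart relations
`c_j(xa, xb) · e l = c_l(xa, xb)` (`reesChartBase_apply_eq_mul_chartGen`), and the base part of the
augmentation ideal is `(xa, xb)` (`JordanThree.span_smul_sub_eq_centre`, p480312). Conclusions
(`k3_chart<j>_span_eq`): the augmentation ideal `(xa, xb) + (a (e l) - e l : l ≠ j)` is
* `j = 0` (chart A, `x_b = x_a t`): `⊤` (`a t - t = m`);
* `j = 1` (chart B2a, `u = x_a/x_b`, `y = x_b³/x_a²`, `x_a = u³ y`, `x_b = u² y`): `(u²)` — uses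
  `3 = 0` (`a y = y (1 + m u)³ = y (1 + m³ u³)`) and locality (`1 + m u` is a unit);
* `j = 2` (the redundant torus chart): `⊤` (`x_b · (x_a/x_b²) · (x_b/x_a) = 1`, so `x_b` is a unit);
* `j = 3` (chart B2b, `w = x_b²/x_a`, `z = x_a²/x_b³`, `x_a = w³ z²`, `x_b = w² z`): `(x_b) = (w² z)` —
  uses `3 = 0` (`a z · (1 + m w z)³ = z`);
* `j = 4` (chart B1, `v = x_a/x_b²`, `x_a = v x_b²`): `(x_b)`.
So at every fixed point of the lifted action the stalk augmentation ideal is principal: the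
Király–Lütkebohmert terminal state (`hdiv`) for `Bl_{K₃} 𝔸ⁿ`, in characteristic 3 exactly.
-/

-- single-problem summit: the doubled namespace component `ResolutionOfSingularities` is forced
set_option linter.dupNamespace false

noncomputable section

namespace Summit.ResolutionOfSingularities.ResolutionOfSingularities.Theorems.WildQuotientResolution.JordanThree

universe u

variable {S : Type u} [CommRing S]

/-- Product rule for moves: `a (x y) - x y = (a x - x) · a y + x · (a y - y)`. [folklore] -/
theorem map_mul_sub_mul_mem (a : S →+* S) (I : Ideal S) {x y : S} (hx : a x - x ∈ I)
    (hy : a y - y ∈ I) : a (x * y) - x * y ∈ I := by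
  have e : a (x * y) - x * y = (a x - x) * a y + x * (a y - y) := by rw [map_mul]; ring
  rw [e]
  exact I.add_mem (I.mul_mem_right _ hx) (I.mul_mem_left _ hy)

/-- Power rule for moves. [folklore] -/
theorem map_pow_sub_pow_mem (a : S →+* S) (I : Ideal S) {x : S} (hx : a x - x ∈ I) (n : ℕ) :
    a (x ^ n) - x ^ n ∈ I := by
  induction n with
  | zero => simp
  | succ n ih =>
    rw [pow_succ]
    exact map_mul_sub_mul_mem a I ih hx

/-- **Chart A (`j = 0`, chart generator `x_a⁴`)**: the generator `t = e 1 = x_b/x_a` moves by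
`a t = t + m`, a unit, so the augmentation ideal is `⊤`. [folklore] -/
theorem k3_chart0_span_eq [IsDomain S] (xa xb m : S) (hxa : xa ≠ 0) (hm : IsUnit m)
    (a : S →+* S) (ha : a xa = xa) (hb : a xb = xb + m * xa)
    (e : {l : Fin 5 // l ≠ (0 : Fin 5)} → S)
    (he : ∀ l, xa ^ 4 * e l =
      (![xa ^ 4, xa ^ 3 * xb, xa ^ 2 * xb ^ 3, xa * xb ^ 4, xb ^ 6] : Fin 5 → S) l.1) :
    Ideal.span ({xa, xb} : Set S) ⊔ Ideal.span (Set.range fun l => a (e l) - e l) = ⊤ := by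
  set t : S := e ⟨1, by decide⟩ with ht
  have h1 : xa ^ 4 * t = xa ^ 3 * xb := he ⟨1, by decide⟩
  have hxb : xa * t = xb := by
    have h : xa ^ 3 * (xa * t) = xa ^ 3 * xb := by linear_combination h1
    exact mul_left_cancel₀ (pow_ne_zero 3 hxa) h
  have hmove : a t - t = m := by
    have h := congrArg a hxb
    rw [map_mul, ha, hb, ← hxb] at h
    have h' : xa * a t = xa * (t + m) := by linear_combination h
    have := mul_left_cancel₀ hxa h'
    linear_combination this
  refine Ideal.eq_top_of_isUnit_mem _ ?_ hm
  rw [← hmove]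
  exact Ideal.mem_sup_right (Ideal.subset_span ⟨⟨1, by decide⟩, rfl⟩)

/-- **Chart B2a (`j = 1`, chart generator `x_a³ x_b`)**: with `u = e 0 = x_a/x_b`,
`y = e 3 = x_b³/x_a²` one has `x_a = u³ y`, `x_b = u² y`, `e 2 = u y`, `e 4 = u y²`, the moves
`a u · (1 + m u) = u`, `a y = y (1 + m u)³`, and in characteristic `3` the augmentation ideal is the
principal ideal `(u²)` (`u² = -m⁻¹ (1 + m u) (a u - u)`; `a y - y = m³ u³ y`). [folklore] -/
theorem k3_chart1_span_eq [IsDomain S] [IsLocalRing S] (xa xb m : S) (hxa : xa ≠ 0) (hxb : xb ≠ 0)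
    (hm : IsUnit m) (h3 : (3 : S) = 0)
    (a : S →+* S) (ha : a xa = xa) (hb : a xb = xb + m * xa)
    (e : {l : Fin 5 // l ≠ (1 : Fin 5)} → S)
    (he : ∀ l, xa ^ 3 * xb * e l =
      (![xa ^ 4, xa ^ 3 * xb, xa ^ 2 * xb ^ 3, xa * xb ^ 4, xb ^ 6] : Fin 5 → S) l.1) :
    Ideal.span ({xa, xb} : Set S) ⊔ Ideal.span (Set.range fun l => a (e l) - e l) =
      Ideal.span ({e ⟨0, by decide⟩ ^ 2} : Set S) := by
  set u : S := e ⟨0, by decide⟩ with hu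
  set q : S := e ⟨2, by decide⟩ with hq
  set y : S := e ⟨3, by decide⟩ with hy
  set r : S := e ⟨4, by decide⟩ with hr
  have h0 : xa ^ 3 * xb * u = xa ^ 4 := he ⟨0, by decide⟩
  have h2 : xa ^ 3 * xb * q = xa ^ 2 * xb ^ 3 := he ⟨2, by decide⟩
  have h3' : xa ^ 3 * xb * y = xa * xb ^ 4 := he ⟨3, by decide⟩
  have h4 : xa ^ 3 * xb * r = xb ^ 6 := he ⟨4, by decide⟩
  -- the monomial parametrisation
  have hxa1 : xb * u = xa := by
    have h : xa ^ 3 * (xb * u) = xa ^ 3 * xa := by linear_combination h0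
    exact mul_left_cancel₀ (pow_ne_zero 3 hxa) h
  have hu0 : u ≠ 0 := by rintro h0u; rw [h0u, mul_zero] at hxa1; exact hxa hxa1.symm
  have hxb1 : u ^ 2 * y = xb := by
    have h : xa * xb * (xa ^ 2 * y) = xa * xb * xb ^ 3 := by linear_combination h3'
    have h' : xa ^ 2 * y = xb ^ 3 := mul_left_cancel₀ (mul_ne_zero hxa hxb) h
    rw [← hxa1] at h'
    have h'' : xb ^ 2 * (u ^ 2 * y) = xb ^ 2 * xb := by linear_combination h'
    exact mul_left_cancel₀ (pow_ne_zero 2 hxb) h''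
  have hy0 : y ≠ 0 := by rintro h0y; rw [h0y, mul_zero] at hxb1; exact hxb hxb1.symm
  have hxa2 : xa = u ^ 3 * y := by rw [← hxa1, ← hxb1]; ring
  have hq1 : q = u * y := by
    have h : xa ^ 2 * xb * (xa * q) = xa ^ 2 * xb * xb ^ 2 := by linear_combination h2
    have h' : xa * q = xb ^ 2 := mul_left_cancel₀ (mul_ne_zero (pow_ne_zero 2 hxa) hxb) h
    rw [hxa2, ← hxb1] at h'
    have h'' : u ^ 3 * y * q = u ^ 3 * y * (u * y) := by linear_combination h'
    exact mul_left_cancel₀ (mul_ne_zero (pow_ne_zero 3 hu0) hy0) h''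
  have hr1 : r = u * y ^ 2 := by
    have h : xb * (xa ^ 3 * r) = xb * xb ^ 5 := by linear_combination h4
    have h' : xa ^ 3 * r = xb ^ 5 := mul_left_cancel₀ hxb h
    rw [hxa2, ← hxb1] at h'
    have h'' : u ^ 9 * y ^ 3 * r = u ^ 9 * y ^ 3 * (u * y ^ 2) := by linear_combination h'
    exact mul_left_cancel₀ (mul_ne_zero (pow_ne_zero 9 hu0) (pow_ne_zero 3 hy0)) h''
  -- the action: `a x_b = x_b (1 + m u)`
  have hb' : a xb = xb * (1 + m * u) := by rw [hb, ← hxa1]; ring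
  have hau : a u * (1 + m * u) = u := by
    have h := congrArg a hxa1
    rw [map_mul, ha, hb', ← hxa1] at h
    have h' : xb * (a u * (1 + m * u)) = xb * u := by linear_combination h
    exact mul_left_cancel₀ hxb h'
  have hε : IsUnit (1 + m * u) := isUnit_one_add_mul_of_mul_eq u (a u) m hau
  have hay : a y = y * (1 + m * u) ^ 3 := by
    have hrel : xa ^ 2 * y = xb ^ 3 := by rw [hxa2, ← hxb1]; ring
    have h := congrArg a hrel
    rw [map_mul, map_pow, map_pow, ha, hb'] at h
    have h' : xa ^ 2 * a y = xa ^ 2 * (y * (1 + m * u) ^ 3) := by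
      linear_combination h - (1 + m * u) ^ 3 * hrel
    exact mul_left_cancel₀ (pow_ne_zero 2 hxa) h'
  obtain ⟨m', hmm'⟩ := hm.exists_right_inv
  obtain ⟨ε', hεε'⟩ := hε.exists_right_inv
  -- the moves land in `(u²)`
  set I : Ideal S := Ideal.span ({u ^ 2} : Set S) with hI
  have hmu : a u - u ∈ I := by
    refine Ideal.mem_span_singleton'.mpr ⟨-(m * ε'), ?_⟩
    linear_combination (a u - u) * hεε' - ε' * hau
  have hmy : a y - y ∈ I := by
    refine Ideal.mem_span_singleton'.mpr ⟨m ^ 3 * u * y, ?_⟩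
    linear_combination (-1 : S) * hay + (-(y * (m * u + m ^ 2 * u ^ 2))) * h3
  apply le_antisymm
  · refine sup_le ?_ ?_
    · refine Ideal.span_le.mpr ?_
      intro x hx
      simp only [Set.mem_insert_iff, Set.mem_singleton_iff] at hx
      rcases hx with rfl | rfl
      · rw [hxa2]
        exact Ideal.mem_span_singleton'.mpr ⟨u * y, by ring⟩
      · rw [← hxb1]
        exact Ideal.mem_span_singleton'.mpr ⟨y, by ring⟩
    · refine Ideal.span_le.mpr ?_
      rintro _ ⟨⟨l, hl⟩, rfl⟩
      fin_cases l
      · exact hmu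
      · exact absurd rfl hl
      · change a q - q ∈ I
        rw [hq1]
        exact map_mul_sub_mul_mem a I hmu hmy
      · exact hmy
      · change a r - r ∈ I
        rw [hr1]
        exact map_mul_sub_mul_mem a I hmu (map_pow_sub_pow_mem a I hmy 2)
  · rw [hI, Ideal.span_singleton_le_iff_mem]
    have hmem : (-(m' * (1 + m * u))) * (a u - u) ∈
        Ideal.span ({xa, xb} : Set S) ⊔ Ideal.span (Set.range fun l => a (e l) - e l) :=
      Ideal.mem_sup_right (Ideal.mul_mem_left _ _ (Ideal.subset_span ⟨⟨0, by decide⟩, rfl⟩))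
    have e : (-(m' * (1 + m * u))) * (a u - u) = u ^ 2 := by
      linear_combination (-m') * hau + u ^ 2 * hmm'
    rwa [e] at hmem

/-- **Chart `j = 2` (chart generator `x_a² x_b³`)**: `x_b · (x_a/x_b²) · (x_b/x_a) = 1`, so `x_b` is a
unit on this chart and the augmentation ideal (which contains `x_b`) is `⊤`. [folklore] -/
theorem k3_chart2_span_eq [IsDomain S] (xa xb : S) (hxa : xa ≠ 0) (hxb : xb ≠ 0)
    (a : S →+* S) (e : {l : Fin 5 // l ≠ (2 : Fin 5)} → S)
    (he : ∀ l, xa ^ 2 * xb ^ 3 * e l =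
      (![xa ^ 4, xa ^ 3 * xb, xa ^ 2 * xb ^ 3, xa * xb ^ 4, xb ^ 6] : Fin 5 → S) l.1) :
    Ideal.span ({xa, xb} : Set S) ⊔ Ideal.span (Set.range fun l => a (e l) - e l) = ⊤ := by
  have h1 : xa ^ 2 * xb ^ 3 * e ⟨1, by decide⟩ = xa ^ 3 * xb := he ⟨1, by decide⟩
  have h3 : xa ^ 2 * xb ^ 3 * e ⟨3, by decide⟩ = xa * xb ^ 4 := he ⟨3, by decide⟩
  have h1' : xb ^ 2 * e ⟨1, by decide⟩ = xa := by
    have h : xa ^ 2 * xb * (xb ^ 2 * e ⟨1, by decide⟩) = xa ^ 2 * xb * xa := by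
      linear_combination h1
    exact mul_left_cancel₀ (mul_ne_zero (pow_ne_zero 2 hxa) hxb) h
  have h3' : xa * e ⟨3, by decide⟩ = xb := by
    have h : xa * xb ^ 3 * (xa * e ⟨3, by decide⟩) = xa * xb ^ 3 * xb := by
      linear_combination h3
    exact mul_left_cancel₀ (mul_ne_zero hxa (pow_ne_zero 3 hxb)) h
  have hunit : xb * (e ⟨1, by decide⟩ * e ⟨3, by decide⟩) = 1 := by
    have h : xb * (xb * (e ⟨1, by decide⟩ * e ⟨3, by decide⟩)) = xb * 1 := by
      rw [← h1'] at h3'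
      linear_combination h3'
    exact mul_left_cancel₀ hxb h
  refine Ideal.eq_top_of_isUnit_mem _ ?_ (IsUnit.of_mul_eq_one _ hunit)
  exact Ideal.mem_sup_left (Ideal.subset_span (Set.mem_insert_of_mem _ (Set.mem_singleton _)))

/-- **Chart B2b (`j = 3`, chart generator `x_a x_b⁴`)**: with `w = e 4 = x_b²/x_a`,
`z = e 1 = x_a²/x_b³` one has `e 2 = w z`, `x_b = w² z`, `x_a = w³ z²`, `e 0 = w z²`, the moves
`a w = w (1 + m w z)²`, `a z · (1 + m w z)³ = z`, and in characteristic `3` the augmentation ideal is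
the principal ideal `(x_b) = (w² z)` (`a z - z = -a z · m³ w³ z³`). [folklore] -/
theorem k3_chart3_span_eq [IsDomain S] (xa xb m : S) (hxa : xa ≠ 0) (hxb : xb ≠ 0)
    (h3 : (3 : S) = 0) (a : S →+* S) (ha : a xa = xa) (hb : a xb = xb + m * xa)
    (e : {l : Fin 5 // l ≠ (3 : Fin 5)} → S)
    (he : ∀ l, xa * xb ^ 4 * e l =
      (![xa ^ 4, xa ^ 3 * xb, xa ^ 2 * xb ^ 3, xa * xb ^ 4, xb ^ 6] : Fin 5 → S) l.1) :
    Ideal.span ({xa, xb} : Set S) ⊔ Ideal.span (Set.range fun l => a (e l) - e l) =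
      Ideal.span ({xb} : Set S) := by
  set r : S := e ⟨0, by decide⟩ with hr
  set z : S := e ⟨1, by decide⟩ with hz
  set q : S := e ⟨2, by decide⟩ with hq
  set w : S := e ⟨4, by decide⟩ with hw
  have h0 : xa * xb ^ 4 * r = xa ^ 4 := he ⟨0, by decide⟩
  have h1 : xa * xb ^ 4 * z = xa ^ 3 * xb := he ⟨1, by decide⟩
  have h2 : xa * xb ^ 4 * q = xa ^ 2 * xb ^ 3 := he ⟨2, by decide⟩
  have h4 : xa * xb ^ 4 * w = xb ^ 6 := he ⟨4, by decide⟩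
  -- the monomial parametrisation
  have hw1 : xa * w = xb ^ 2 := by
    have h : xb ^ 4 * (xa * w) = xb ^ 4 * xb ^ 2 := by linear_combination h4
    exact mul_left_cancel₀ (pow_ne_zero 4 hxb) h
  have hq1 : xb * q = xa := by
    have h : xa * xb ^ 3 * (xb * q) = xa * xb ^ 3 * xa := by linear_combination h2
    exact mul_left_cancel₀ (mul_ne_zero hxa (pow_ne_zero 3 hxb)) h
  have hz1 : xb ^ 3 * z = xa ^ 2 := by
    have h : xa * xb * (xb ^ 3 * z) = xa * xb * xa ^ 2 := by linear_combination h1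
    exact mul_left_cancel₀ (mul_ne_zero hxa hxb) h
  have hr0 : xb ^ 4 * r = xa ^ 3 := by
    have h : xa * (xb ^ 4 * r) = xa * xa ^ 3 := by linear_combination h0
    exact mul_left_cancel₀ hxa h
  have hq0 : q ≠ 0 := by rintro h0q; rw [h0q, mul_zero] at hq1; exact hxa hq1.symm
  have hqw : q * w = xb := by
    have h : xb * (q * w) = xb * xb := by
      linear_combination w * hq1 + hw1
    exact mul_left_cancel₀ hxb h
  have hxbz : xb * z = q ^ 2 := by
    have h : xb ^ 2 * (xb * z) = xb ^ 2 * q ^ 2 := by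
      linear_combination hz1 - (xb * q + xa) * hq1
    exact mul_left_cancel₀ (pow_ne_zero 2 hxb) h
  have hq2 : w * z = q := by
    have h : q * (w * z) = q * q := by linear_combination z * hqw + hxbz
    exact mul_left_cancel₀ hq0 h
  have hxb2 : xb = w ^ 2 * z := by rw [← hqw, ← hq2]; ring
  have hxa2 : xa = w ^ 3 * z ^ 2 := by rw [← hq1, hxb2, ← hq2]; ring
  have hw0 : w ≠ 0 := by rintro h0w; rw [h0w] at hxb2; exact hxb (by rw [hxb2]; ring)
  have hz0 : z ≠ 0 := by rintro h0z; rw [h0z] at hxb2; exact hxb (by rw [hxb2]; ring)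
  have hr1 : r = w * z ^ 2 := by
    rw [hxa2, hxb2] at hr0
    have h : w ^ 8 * z ^ 4 * r = w ^ 8 * z ^ 4 * (w * z ^ 2) := by linear_combination hr0
    exact mul_left_cancel₀ (mul_ne_zero (pow_ne_zero 8 hw0) (pow_ne_zero 4 hz0)) h
  -- the action: `a x_b = x_b (1 + m w z)`
  have hb' : a xb = xb * (1 + m * (w * z)) := by rw [hb, hxa2, hxb2]; ring
  have haw : a w = w * (1 + m * (w * z)) ^ 2 := by
    have h := congrArg a hw1
    rw [map_mul, map_pow, ha, hb'] at h
    have h' : xa * a w = xa * (w * (1 + m * (w * z)) ^ 2) := by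
      linear_combination h - (1 + m * (w * z)) ^ 2 * hw1
    exact mul_left_cancel₀ hxa h'
  have haz : a z * (1 + m * (w * z)) ^ 3 = z := by
    have h := congrArg a hz1
    rw [map_mul, map_pow, map_pow, ha, hb', ← hz1] at h
    have h' : xb ^ 3 * (a z * (1 + m * (w * z)) ^ 3) = xb ^ 3 * z := by linear_combination h
    exact mul_left_cancel₀ (pow_ne_zero 3 hxb) h'
  -- the moves land in `(x_b) = (w² z)`
  set I : Ideal S := Ideal.span ({xb} : Set S) with hI
  have hxbI : xb ∈ I := Ideal.subset_span (Set.mem_singleton _)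
  have hmw : a w - w ∈ I := by
    refine Ideal.mem_span_singleton'.mpr ⟨2 * m + m ^ 2 * (w * z), ?_⟩
    rw [hxb2]
    linear_combination (-1 : S) * haw
  have hmz : a z - z ∈ I := by
    refine Ideal.mem_span_singleton'.mpr ⟨-(a z * m ^ 3 * w * z ^ 2), ?_⟩
    rw [hxb2]
    linear_combination (-1 : S) * haz + (a z * (m * (w * z) + m ^ 2 * (w * z) ^ 2)) * h3
  apply le_antisymm
  · refine sup_le ?_ ?_
    · refine Ideal.span_le.mpr ?_
      intro x hx
      simp only [Set.mem_insert_iff, Set.mem_singleton_iff] at hx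
      rcases hx with rfl | rfl
      · rw [← hq1]
        exact I.mul_mem_right _ hxbI
      · exact hxbI
    · refine Ideal.span_le.mpr ?_
      rintro _ ⟨⟨l, hl⟩, rfl⟩
      fin_cases l
      · change a r - r ∈ I
        rw [hr1]
        exact map_mul_sub_mul_mem a I hmw (map_pow_sub_pow_mem a I hmz 2)
      · exact hmz
      · change a q - q ∈ I
        rw [← hq2]
        exact map_mul_sub_mul_mem a I hmw hmz
      · exact absurd rfl hl
      · exact hmw
  · rw [hI, Ideal.span_singleton_le_iff_mem]
    exact Ideal.mem_sup_left (Ideal.subset_span (Set.mem_insert_of_mem _ (Set.mem_singleton _)))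

/-- **Chart B1 (`j = 4`, chart generator `x_b⁶`)**: with `v = e 3 = x_a/x_b²` one has
`x_a = v x_b²`, `e 0 = x_b² v⁴`, `e 1 = x_b v³`, `e 2 = x_b v²`, the move `a v · (1 + m x_b v)² = v`,
and the augmentation ideal is the principal ideal `(x_b)` (any characteristic, any `m`). [folklore] -/
theorem k3_chart4_span_eq [IsDomain S] (xa xb m : S) (hxa : xa ≠ 0) (hxb : xb ≠ 0)
    (a : S →+* S) (ha : a xa = xa) (hb : a xb = xb + m * xa)
    (e : {l : Fin 5 // l ≠ (4 : Fin 5)} → S)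
    (he : ∀ l, xb ^ 6 * e l =
      (![xa ^ 4, xa ^ 3 * xb, xa ^ 2 * xb ^ 3, xa * xb ^ 4, xb ^ 6] : Fin 5 → S) l.1) :
    Ideal.span ({xa, xb} : Set S) ⊔ Ideal.span (Set.range fun l => a (e l) - e l) =
      Ideal.span ({xb} : Set S) := by
  set e0 : S := e ⟨0, by decide⟩ with he0
  set e1 : S := e ⟨1, by decide⟩ with he1
  set e2 : S := e ⟨2, by decide⟩ with he2
  set v : S := e ⟨3, by decide⟩ with hv
  have h0 : xb ^ 6 * e0 = xa ^ 4 := he ⟨0, by decide⟩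
  have h1 : xb ^ 6 * e1 = xa ^ 3 * xb := he ⟨1, by decide⟩
  have h2 : xb ^ 6 * e2 = xa ^ 2 * xb ^ 3 := he ⟨2, by decide⟩
  have h3 : xb ^ 6 * v = xa * xb ^ 4 := he ⟨3, by decide⟩
  -- the monomial parametrisation
  have hxa1 : xb ^ 2 * v = xa := by
    have h : xb ^ 4 * (xb ^ 2 * v) = xb ^ 4 * xa := by linear_combination h3
    exact mul_left_cancel₀ (pow_ne_zero 4 hxb) h
  have he0' : e0 = xb ^ 2 * v ^ 4 := by
    have h : xb ^ 6 * e0 = xb ^ 6 * (xb ^ 2 * v ^ 4) := by rw [h0, ← hxa1]; ring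
    exact mul_left_cancel₀ (pow_ne_zero 6 hxb) h
  have he1' : e1 = xb * v ^ 3 := by
    have h : xb ^ 6 * e1 = xb ^ 6 * (xb * v ^ 3) := by rw [h1, ← hxa1]; ring
    exact mul_left_cancel₀ (pow_ne_zero 6 hxb) h
  have he2' : e2 = xb * v ^ 2 := by
    have h : xb ^ 6 * e2 = xb ^ 6 * (xb * v ^ 2) := by rw [h2, ← hxa1]; ring
    exact mul_left_cancel₀ (pow_ne_zero 6 hxb) h
  -- the action: `a x_b = x_b (1 + m x_b v)`
  have hb' : a xb = xb * (1 + m * (xb * v)) := by rw [hb, ← hxa1]; ring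
  have hav : a v * (1 + m * (xb * v)) ^ 2 = v := by
    have h := congrArg a hxa1
    rw [map_mul, map_pow, ha, hb', ← hxa1] at h
    have h' : xb ^ 2 * (a v * (1 + m * (xb * v)) ^ 2) = xb ^ 2 * v := by linear_combination h
    exact mul_left_cancel₀ (pow_ne_zero 2 hxb) h'
  -- the moves land in `(x_b)`
  set I : Ideal S := Ideal.span ({xb} : Set S) with hI
  have hxbI : xb ∈ I := Ideal.subset_span (Set.mem_singleton _)
  have hmxb : a xb - xb ∈ I := by
    refine Ideal.mem_span_singleton'.mpr ⟨m * (xb * v), ?_⟩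
    linear_combination (-1 : S) * hb'
  have hmv : a v - v ∈ I := by
    refine Ideal.mem_span_singleton'.mpr ⟨-(a v * (2 * m * v + m ^ 2 * xb * v ^ 2)), ?_⟩
    linear_combination (-1 : S) * hav
  apply le_antisymm
  · refine sup_le ?_ ?_
    · refine Ideal.span_le.mpr ?_
      intro x hx
      simp only [Set.mem_insert_iff, Set.mem_singleton_iff] at hx
      rcases hx with rfl | rfl
      · rw [← hxa1]
        exact Ideal.mem_span_singleton'.mpr ⟨xb * v, by ring⟩
      · exact hxbI
    · refine Ideal.span_le.mpr ?_
      rintro _ ⟨⟨l, hl⟩, rfl⟩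
      fin_cases l
      · change a e0 - e0 ∈ I
        rw [he0']
        exact map_mul_sub_mul_mem a I (map_pow_sub_pow_mem a I hmxb 2)
          (map_pow_sub_pow_mem a I hmv 4)
      · change a e1 - e1 ∈ I
        rw [he1']
        exact map_mul_sub_mul_mem a I hmxb (map_pow_sub_pow_mem a I hmv 3)
      · change a e2 - e2 ∈ I
        rw [he2']
        exact map_mul_sub_mul_mem a I hmxb (map_pow_sub_pow_mem a I hmv 2)
      · exact hmv
      · exact absurd rfl hl
  · rw [hI, Ideal.span_singleton_le_iff_mem]
    exact Ideal.mem_sup_left (Ideal.subset_span (Set.mem_insert_of_mem _ (Set.mem_singleton _)))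

end Summit.ResolutionOfSingularities.ResolutionOfSingularities.Theorems.WildQuotientResolution.JordanThree

end
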